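import Mathlib
import HarnessLib
import Summits.NavierStokesRegularity.NavierStokesRegularity.Theorems.PoloidalWindowDoorPoloidalWindowRigidityPoloidalExtremal
import Summits.NavierStokesRegularity.NavierStokesRegularity.Theorems.PoloidalWindowDoorPoloidalWindowRigidityZoomOut
import Summits.NavierStokesRegularity.NavierStokesRegularity.Theorems.PoloidalWindowDoorPoloidalWindowRigidityOneSlice
import Summits.NavierStokesRegularity.NavierStokesRegularity.Theorems.PoloidalWindowDoorPoloidalWindowRigidityClassRate
import Summits.NavierStokesRegularity.NavierStokesRegularity.Theorems.PoloidalWindowDoorPoloidalWindowRigidityWindow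
import Summits.NavierStokesRegularity.NavierStokesRegularity.Theorems.PoloidalWindowDoorPoloidalWindowRigidityFlat

/-!
# Route `PoloidalWindowDoor`, crux `PoloidalWindowRigidity` (K2, stmt-NavierStokesRegularity-19708), line «lrc-jet» —
# THE FLAT DOOR AT `t = −∞`: a poloidal profile whose vertical velocity becomes horizontally flat backward in time
# (in scale-invariant size) is trivial; hence the GROWTH BRANCH of the stratum (TV) «time-dependent proportional
# shear with `|μ(τ)| → ∞`» is EMPTY

Cell ns-regularity-ideate, K2 lead ns-poloidal-K2-p1 (gen 4; support theorem `--supports stmt-…-19708`, LEAD LINE #1: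
the growth half (G) of the registered-to-be stub `stub_tv` of skeleton lrc-jet v2).

The located residual of the lrc-jet dichotomy with SPATIAL pins (ns-poloidal-K2-p3 `…TimeShear`, `…TimeShearPressure`;
refuter1's (TV) witness) is the stratum (TV): every slice `s < 0` is proportional-shear, `∂₂v_b(s,·) = μ(s) ∂_b v₂(s,·)`
(`b = 0,1`), with an analytic negative non-constant slope `μ`.  ns-poloidal-K2-p2's variance mechanism M12 closes it when
`μ` stays bounded along a sequence of times `τ → −∞`; its honest residual (K2-p3, TV-RESIDUAL §3) is the growth branch
`μ(τ) → −∞`.  That branch needs NO variance law — it is an instance of a general asymptotic stratum theorem, the twin for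
the vertical velocity of K2-p2's one-direction door at `−∞` (`…OneDirectionPast`):

* `tendsto_zero_of_horizontalDeriv_vertical` — for a profile of the route's Type-I class, poloidal along `e₃` on every
  slice: if for ONE horizontal direction `a` (`a ≠ 0`, `a ⟂ e₃`) the scale-invariant horizontal derivative of the
  vertical velocity tends to zero backward in time, `∀ ε > 0 ∃ T ∀ t < T ∀ x, (−t)|⟪Dv(t)(x)[a], e₃⟫| ≤ ε`, then
  `sup_x √(−t)‖v(t,x)‖ → 0` as `t → −∞`.  Proof: at bad points `(t_k, x_k)` the recentred parabolic zooms are poloidal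
  members of the KNSS class `𝔓(C)`; KNSS compactness WITH GRADIENTS (tree `exists_tendsto_of_isTypeIAncientMild_seq`)
  gives a poloidal limit `W` (`poloidal_of_tendsto`) with `‖W(−1,0)‖ ≥ ε` whose vertical velocity is flat along `a` on
  every slice (the hypothesis is scale-invariant, so the zoomed bound is `δ/(−s)` for every `δ > 0`); nsreg-p6's
  one-slice flat stratum `…OneSlice.eq_zero_of_flat_slice` makes `W ≡ 0` — contradiction.
* `eq_zero_of_horizontalDeriv_vertical_tendsto_zero` / `nonflatLiouville_of_horizontalDeriv_vertical_tendsto_zero` —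
  hence such a profile vanishes (K2-p2's `…ZoomOut.eq_zero_of_tendsto_zero`: backward ε-regularity + analyticity).
* `eq_zero_of_timeShear_unbounded` / `nonflatLiouville_of_timeShear_unbounded` — **THE GROWTH BRANCH OF (TV)**: class +
  poloidal + all-slices proportional shear with a slope function `μ` such that `|μ(τ)| → ∞` as `τ → −∞`
  (`∀ M ∃ T ∀ τ < T, M ≤ |μ τ|`) ⇒ `v ≡ 0`: `|∂₀v₂| = |∂₂v₀|/|μ| ≤ C₁/((−τ)|μ(τ)|)` by nsreg-p7's gradient rate
  `…ClassRate.exists_fderiv_rate_of_class`, so the first theorem applies with `a = e₀`.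

So stub_tv of lrc-jet v2 is reduced to its bounded-along-a-sequence half «`∃ M ∀ T ∃ τ < T, |μ τ| ≤ M` ⇒ `v ≡ 0`»
(ns-poloidal-K2-p2 g3, M12 with the Grönwall started along that sequence).

WHAT THIS IS NOT: not a claim about Navier–Stokes regularity, not LRC″ and not (TV) — one settled asymptotic stratum of
the whole poloidal class and the growth half of one registered-to-be stub (bears_on LADDER-NS N0, rung
N0-LocalTubeDoorPoloidal).
-/

noncomputable section

-- the summit and its single sub-problem share the name (CONVENTIONS §1), as in every Theorems file
set_option linter.dupNamespace false

namespace Summit.NavierStokesRegularity.NavierStokesRegularity.Theorems.PoloidalWindowDoorPoloidalWindowRigidityHorizontalFlatPast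

open MeasureTheory Set Function Filter Topology
open scoped RealInnerProductSpace InnerProductSpace
open Literature.Analysis Literature.Analysis.FluidPDE
open Summit.NavierStokesRegularity.NavierStokesRegularity.Theorems
open Summit.NavierStokesRegularity.NavierStokesRegularity.Theorems.PoloidalWindowDoorPoloidalWindowRigidityPoloidalExtremal
open Summit.NavierStokesRegularity.NavierStokesRegularity.Theorems.PoloidalWindowDoorPoloidalWindowRigidityZoomOut
open Summit.NavierStokesRegularity.NavierStokesRegularity.Theorems.PoloidalWindowDoorPoloidalWindowRigidityOneSlice
open Summit.NavierStokesRegularity.NavierStokesRegularity.Theorems.PoloidalWindowDoorPoloidalWindowRigidityClassRate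
open Summit.NavierStokesRegularity.NavierStokesRegularity.Theorems.PoloidalWindowDoorPoloidalWindowRigidityWindow
open Summit.NavierStokesRegularity.NavierStokesRegularity.Theorems.PoloidalWindowDoorPoloidalWindowRigidityFlat

variable {C : ℝ} {v : ℝ → EuclideanSpace ℝ (Fin 3) → EuclideanSpace ℝ (Fin 3)}

/-! ### The flat door at `t = −∞` -/

/-- **Asymptotically flat vertical velocity at `−∞` ⇒ small at `−∞`.**  Let `v` be a profile of the route's Type-I
class, poloidal along `e₃` on every slice, and let `a` be a horizontal direction (`a ≠ 0`, `⟪a, e₃⟫ = 0`).  If the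
scale-invariant derivative of the vertical velocity along `a` tends to zero backward in time,
`∀ ε > 0 ∃ T ∀ t < T ∀ x, (−t)|⟪Dv(t)(x)[a], e₃⟫| ≤ ε`, then `sup_x √(−t)‖v(t,x)‖ → 0` as `t → −∞`. -/
theorem tendsto_zero_of_horizontalDeriv_vertical (hrate : HasTypeITimeDecay C v)
    (hcont : ContinuousOn (uncurry v) (Iio (0 : ℝ) ×ˢ univ))
    (hmild : ∀ s t : ℝ, s < t → t < 0 → ∀ x,
      v t x = UnboundedOperators.heatExtension (v s) (t - s) x - oseenDuhamel 1 s v v t x)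
    (hdiv : ∀ t < 0, VectorCalculus.IsDivFree (v t))
    (hpol : ∀ s < 0, ∀ y, ⟪curl (v s) y, EuclideanSpace.single 2 (1 : ℝ)⟫_ℝ = 0)
    {a : EuclideanSpace ℝ (Fin 3)} (ha : a ≠ 0) (ha3 : ⟪a, EuclideanSpace.single 2 (1 : ℝ)⟫_ℝ = 0)
    (hdir : ∀ ε : ℝ, 0 < ε → ∃ T : ℝ, ∀ t < T, ∀ x,
      (-t) * |⟪fderiv ℝ (v t) x a, EuclideanSpace.single 2 (1 : ℝ)⟫_ℝ| ≤ ε) :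
    ∀ ε : ℝ, 0 < ε → ∃ T : ℝ, T < 0 ∧ ∀ t < T, ∀ x, Real.sqrt (-t) * ‖v t x‖ ≤ ε := by
  intro ε hε
  by_contra hcon
  push Not at hcon
  -- ## a bad sequence `t_k < −(k+1)`, `x_k`
  have hch : ∀ k : ℕ, ∃ t : ℝ, t < -((k : ℝ) + 1) ∧ ∃ x, ε < Real.sqrt (-t) * ‖v t x‖ := fun k =>
    hcon _ (by have : (0 : ℝ) ≤ k := Nat.cast_nonneg k; linarith)
  choose tk htk xk hxk using hch
  have htk0 : ∀ k, tk k < 0 := fun k => by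
    have := htk k; have : (0 : ℝ) ≤ k := Nat.cast_nonneg k; linarith
  set c : ℕ → ℝ := fun k => Real.sqrt (-tk k) with hcdef
  have hc0 : ∀ k, 0 < c k := fun k => Real.sqrt_pos.2 (neg_pos.2 (htk0 k))
  have hc2 : ∀ k, c k ^ 2 = -tk k := fun k => Real.sq_sqrt (neg_pos.2 (htk0 k)).le
  have hcinf : Tendsto c atTop atTop := by
    have h1 : Tendsto (fun k : ℕ => Real.sqrt ((k : ℝ) + 1)) atTop atTop :=
      Real.tendsto_sqrt_atTop.comp (tendsto_natCast_atTop_atTop.atTop_add tendsto_const_nhds)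
    refine tendsto_atTop_mono (fun k => ?_) h1
    exact Real.sqrt_le_sqrt (by have := htk k; linarith)
  -- ## the recentred zooms: poloidal members of the KNSS class `𝔓(C)`
  have hA : IsTypeIAncientMild C v := isTypeIAncientMild_of_class hrate hcont hmild hdiv
  set vk : ℕ → ℝ → EuclideanSpace ℝ (Fin 3) → EuclideanSpace ℝ (Fin 3) := fun k =>
    nsRescale (c k) (fun t x => v t (xk k + x)) with hvk_def
  have hvk : ∀ k, IsTypeIAncientMild C (vk k) := fun k =>
    isTypeIAncientMild_nsRescale (isTypeIAncientMild_translate hA (xk k)) (hc0 k)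
  have hvkpol : ∀ k, ∀ s < 0, ∀ y, ⟪curl (vk k s) y, EuclideanSpace.single 2 (1 : ℝ)⟫_ℝ = 0 := fun k =>
    poloidal_nsRescale (poloidal_translate hpol (xk k)) (hc0 k)
  have hval : ∀ k, ‖vk k (-1) 0‖ = Real.sqrt (-tk k) * ‖v (tk k) (xk k)‖ := fun k => by
    simp only [hvk_def]
    rw [nsRescale_apply, smul_zero, add_zero, mul_neg_one, hc2 k, neg_neg, norm_smul,
      Real.norm_of_nonneg (Real.sqrt_nonneg _)]
  -- ## KNSS compactness, fields AND gradients
  obtain ⟨φ, hφ, W, hW, hpt, hDpt, -, -⟩ := exists_tendsto_of_isTypeIAncientMild_seq C hvk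
  have hWpol : ∀ s < 0, ∀ y, ⟪curl (W s) y, EuclideanSpace.single 2 (1 : ℝ)⟫_ℝ = 0 := fun s hs y =>
    poloidal_of_tendsto (hDpt s hs y) fun j => hvkpol (φ j) s hs y
  -- the limit is not small at the hot spot
  have hnorm : ε ≤ ‖W (-1) 0‖ := by
    refine ge_of_tendsto ((hpt (-1) (by norm_num) 0).norm) (Eventually.of_forall fun j => ?_)
    rw [hval]
    exact (hxk (φ j)).le
  -- ## the limit's vertical velocity is flat along `a` on every slice
  have hflat : ∀ s < 0, ∀ y, ⟪fderiv ℝ (W s) y a, EuclideanSpace.single 2 (1 : ℝ)⟫_ℝ = 0 := by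
    intro s hs y
    have hs' : 0 < -s := neg_pos.2 hs
    -- the scalar sequence and its limit
    have hlim : Tendsto (fun j => ⟪fderiv ℝ (vk (φ j) s) y a, EuclideanSpace.single 2 (1 : ℝ)⟫_ℝ) atTop
        (𝓝 ⟪fderiv ℝ (W s) y a, EuclideanSpace.single 2 (1 : ℝ)⟫_ℝ) :=
      (((ContinuousLinearMap.apply ℝ (EuclideanSpace ℝ (Fin 3)) a).continuous.tendsto _).comp
        (hDpt s hs y)).inner tendsto_const_nhds
    -- it is eventually bounded by `δ/(−s)` for every `δ > 0`
    have hsmall : ∀ δ : ℝ, 0 < δ → |⟪fderiv ℝ (W s) y a, EuclideanSpace.single 2 (1 : ℝ)⟫_ℝ| ≤ δ / (-s) := by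
      intro δ hδ
      obtain ⟨T, hT⟩ := hdir δ hδ
      have hev : ∀ᶠ j in atTop, c (φ j) ^ 2 * s < T := by
        have h1 : Tendsto (fun j => c (φ j) ^ 2 * (-s)) atTop atTop :=
          Tendsto.atTop_mul_const hs' ((tendsto_pow_atTop two_ne_zero).comp (hcinf.comp hφ.tendsto_atTop))
        filter_upwards [h1.eventually (eventually_gt_atTop (-T))] with j hj
        linarith
      have hbd : ∀ᶠ j in atTop,
          |⟪fderiv ℝ (vk (φ j) s) y a, EuclideanSpace.single 2 (1 : ℝ)⟫_ℝ| ≤ δ / (-s) := by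
        filter_upwards [hev] with j hj
        set σ : ℝ := c (φ j) ^ 2 * s with hσdef
        have hσ0 : σ < 0 := mul_neg_of_pos_of_neg (pow_pos (hc0 _) 2) hs
        have hD : fderiv ℝ (vk (φ j) s) y = c (φ j) ^ 2 • fderiv ℝ (v σ) (xk (φ j) + c (φ j) • y) := by
          simp only [hvk_def]
          rw [fderiv_nsRescale_slice, fderiv_translate]
        rw [hD]
        simp only [_root_.smul_apply, inner_smul_left, conj_trivial, abs_mul]
        rw [abs_of_nonneg (sq_nonneg (c (φ j)))]
        have h1 := hT σ hj (xk (φ j) + c (φ j) • y)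
        have hσs : -σ = c (φ j) ^ 2 * (-s) := by rw [hσdef]; ring
        rw [hσs] at h1
        rw [le_div_iff₀ hs']
        calc c (φ j) ^ 2 * |⟪fderiv ℝ (v σ) (xk (φ j) + c (φ j) • y) a, EuclideanSpace.single 2 (1 : ℝ)⟫_ℝ| * -s
            = c (φ j) ^ 2 * -s *
                |⟪fderiv ℝ (v σ) (xk (φ j) + c (φ j) • y) a, EuclideanSpace.single 2 (1 : ℝ)⟫_ℝ| := by ring
          _ ≤ δ := h1
      exact le_of_tendsto hlim.abs hbd
    -- hence it vanishes
    have hz : |⟪fderiv ℝ (W s) y a, EuclideanSpace.single 2 (1 : ℝ)⟫_ℝ| ≤ 0 := by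
      by_contra hpos
      push Not at hpos
      have h1 := hsmall (|⟪fderiv ℝ (W s) y a, EuclideanSpace.single 2 (1 : ℝ)⟫_ℝ| * (-s) / 2) (by positivity)
      have hs0 : (-s) ≠ 0 := hs'.ne'
      have e1 : |⟪fderiv ℝ (W s) y a, EuclideanSpace.single 2 (1 : ℝ)⟫_ℝ| * (-s) / 2 / (-s) =
          |⟪fderiv ℝ (W s) y a, EuclideanSpace.single 2 (1 : ℝ)⟫_ℝ| / 2 := by
        rw [div_div, mul_comm (2 : ℝ) (-s), ← div_div, mul_div_cancel_right₀ _ hs0]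
      rw [e1] at h1
      linarith
    exact abs_eq_zero.1 (le_antisymm hz (abs_nonneg _))
  -- ## so the limit vanishes (one poloidal slice, flat along `a`) — contradiction
  have hW0 := eq_zero_of_flat_slice hW.hasTypeITimeDecay hW.continuousOn_uncurry
    (fun s t hst ht x => hW.mild_eq_heatExtension hst ht x) (fun t ht => hW.isDivFree ht)
    (s := -1) (by norm_num) (hWpol (-1) (by norm_num)) ha ha3 (hflat (-1) (by norm_num))
  have h0 : W (-1) 0 = 0 := hW0 (-1) (by norm_num) 0
  rw [h0, norm_zero] at hnorm
  linarith

/-- **THE FLAT DOOR AT `t = −∞` (profiles).**  A profile of the route's Type-I class, poloidal along `e₃` on every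
slice, whose vertical velocity becomes flat along ONE horizontal direction backward in time in scale-invariant size
(`(−t)|⟪Dv(t)(x)[a], e₃⟫| → 0` uniformly in `x`), vanishes identically.  (The one-slice flat stratum
`…OneSlice.eq_zero_of_flat_slice` is the case `ε = 0`; this is its asymptotic form at `t = −∞`.) -/
theorem eq_zero_of_horizontalDeriv_vertical_tendsto_zero (hrate : HasTypeITimeDecay C v)
    (hcont : ContinuousOn (uncurry v) (Iio (0 : ℝ) ×ˢ univ))
    (hmild : ∀ s t : ℝ, s < t → t < 0 → ∀ x,
      v t x = UnboundedOperators.heatExtension (v s) (t - s) x - oseenDuhamel 1 s v v t x)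
    (hdiv : ∀ t < 0, VectorCalculus.IsDivFree (v t))
    (hpol : ∀ s < 0, ∀ y, ⟪curl (v s) y, EuclideanSpace.single 2 (1 : ℝ)⟫_ℝ = 0)
    {a : EuclideanSpace ℝ (Fin 3)} (ha : a ≠ 0) (ha3 : ⟪a, EuclideanSpace.single 2 (1 : ℝ)⟫_ℝ = 0)
    (hdir : ∀ ε : ℝ, 0 < ε → ∃ T : ℝ, ∀ t < T, ∀ x,
      (-t) * |⟪fderiv ℝ (v t) x a, EuclideanSpace.single 2 (1 : ℝ)⟫_ℝ| ≤ ε) :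
    ∀ t < 0, ∀ x, v t x = 0 :=
  eq_zero_of_tendsto_zero hrate hcont hmild
    (tendsto_zero_of_horizontalDeriv_vertical hrate hcont hmild hdiv hpol ha ha3 hdir)

/-- The flat door at `t = −∞`: not backward-singular. -/
theorem nonflatLiouville_of_horizontalDeriv_vertical_tendsto_zero (hrate : HasTypeITimeDecay C v)
    (hcont : ContinuousOn (uncurry v) (Iio (0 : ℝ) ×ˢ univ))
    (hmild : ∀ s t : ℝ, s < t → t < 0 → ∀ x,
      v t x = UnboundedOperators.heatExtension (v s) (t - s) x - oseenDuhamel 1 s v v t x)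
    (hdiv : ∀ t < 0, VectorCalculus.IsDivFree (v t))
    (hpol : ∀ s < 0, ∀ y, ⟪curl (v s) y, EuclideanSpace.single 2 (1 : ℝ)⟫_ℝ = 0)
    {a : EuclideanSpace ℝ (Fin 3)} (ha : a ≠ 0) (ha3 : ⟪a, EuclideanSpace.single 2 (1 : ℝ)⟫_ℝ = 0)
    (hdir : ∀ ε : ℝ, 0 < ε → ∃ T : ℝ, ∀ t < T, ∀ x,
      (-t) * |⟪fderiv ℝ (v t) x a, EuclideanSpace.single 2 (1 : ℝ)⟫_ℝ| ≤ ε) :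
    ¬ IsBackwardSingularPoint v 0 :=
  not_backwardSingular_of_zero
    (eq_zero_of_horizontalDeriv_vertical_tendsto_zero hrate hcont hmild hdiv hpol ha ha3 hdir)

/-! ### The growth branch of (TV): proportional shear on every slice with `|μ(τ)| → ∞` -/

/-- **THE GROWTH BRANCH OF (TV) IS EMPTY.**  Let `v` be a profile of the route's Type-I class, poloidal along `e₃`,
every slice of which is proportional-shear — `∂₂v_b(s,y) = μ(s) ∂_b v₂(s,y)` (`b = 0,1`) for some slope function
`μ : ℝ → ℝ` — with `|μ(τ)| → ∞` as `τ → −∞` (`∀ M ∃ T ∀ τ < T, M ≤ |μ τ|`).  Then `v ≡ 0`: by nsreg-p7's gradient rate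
`‖Dv(τ)‖ ≤ C₁/(−τ)`, `(−τ)|∂₀v₂(τ,x)| = (−τ)|∂₂v₀(τ,x)|/|μ(τ)| ≤ C₁/|μ(τ)| → 0`, and the flat door at `−∞` shuts. -/
theorem eq_zero_of_timeShear_unbounded (hrate : HasTypeITimeDecay C v)
    (hcont : ContinuousOn (uncurry v) (Iio (0 : ℝ) ×ˢ univ))
    (hmild : ∀ s t : ℝ, s < t → t < 0 → ∀ x,
      v t x = UnboundedOperators.heatExtension (v s) (t - s) x - oseenDuhamel 1 s v v t x)
    (hdiv : ∀ t < 0, VectorCalculus.IsDivFree (v t))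
    (hpol : ∀ s < 0, ∀ y, ⟪curl (v s) y, EuclideanSpace.single 2 (1 : ℝ)⟫_ℝ = 0) {μ : ℝ → ℝ}
    (hslope : ∀ s < 0, ∀ y, ∀ b : Fin 3, b ≠ 2 →
      fderiv ℝ (v s) y (EuclideanSpace.single 2 1) b = μ s * fderiv ℝ (v s) y (EuclideanSpace.single b 1) 2)
    (hμ : ∀ M : ℝ, ∃ T : ℝ, ∀ τ < T, M ≤ |μ τ|) :
    ∀ t < 0, ∀ x, v t x = 0 := by
  obtain ⟨C₁, hC₁⟩ := exists_fderiv_rate_of_class hrate hcont hmild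
  have he0 : (EuclideanSpace.single 0 1 : EuclideanSpace ℝ (Fin 3)) ≠ 0 := fun h0 => by
    simpa using congrArg (fun w : EuclideanSpace ℝ (Fin 3) => w 0) h0
  have he03 : ⟪(EuclideanSpace.single 0 1 : EuclideanSpace ℝ (Fin 3)), EuclideanSpace.single 2 (1 : ℝ)⟫_ℝ = 0 := by
    simp [EuclideanSpace.inner_single_left]
  refine eq_zero_of_horizontalDeriv_vertical_tendsto_zero hrate hcont hmild hdiv hpol he0 he03 fun ε hε => ?_
  -- choose the threshold `M = |C₁|/ε + 1`
  obtain ⟨T, hT⟩ := hμ (|C₁| / ε + 1)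
  refine ⟨min T 0, fun t ht x => ?_⟩
  have htT : t < T := lt_of_lt_of_le ht (min_le_left _ _)
  have ht0 : t < 0 := lt_of_lt_of_le ht (min_le_right _ _)
  have hnt : 0 < -t := neg_pos.2 ht0
  have hM : |C₁| / ε + 1 ≤ |μ t| := hT t htT
  have hμpos : 0 < |μ t| := lt_of_lt_of_le (by positivity) hM
  -- `∂₀v₂ = ∂₂v₀ / μ`
  have hrel : fderiv ℝ (v t) x (EuclideanSpace.single 2 1) 0 =
      μ t * fderiv ℝ (v t) x (EuclideanSpace.single 0 1) 2 := hslope t ht0 x 0 (by decide)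
  have hcoord : ⟪fderiv ℝ (v t) x (EuclideanSpace.single 0 1), EuclideanSpace.single 2 (1 : ℝ)⟫_ℝ =
      fderiv ℝ (v t) x (EuclideanSpace.single 0 1) 2 := by
    rw [EuclideanSpace.inner_single_right, one_mul, conj_trivial]
  -- `|∂₂v₀| ≤ ‖Dv[e₃]‖ ≤ ‖Dv‖ ≤ C₁/(−t)`
  have h3 : |fderiv ℝ (v t) x (EuclideanSpace.single 2 1) 0| ≤ C₁ / (-t) := by
    have h1 : |fderiv ℝ (v t) x (EuclideanSpace.single 2 1) 0| ≤ ‖fderiv ℝ (v t) x (EuclideanSpace.single 2 1)‖ := by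
      rw [← Real.norm_eq_abs]
      exact PiLp.norm_apply_le _ 0
    have h2 : ‖fderiv ℝ (v t) x (EuclideanSpace.single 2 1)‖ ≤ ‖fderiv ℝ (v t) x‖ := by
      have hn1 : ‖(EuclideanSpace.single 2 (1 : ℝ) : EuclideanSpace ℝ (Fin 3))‖ = 1 := by simp
      refine (ContinuousLinearMap.le_opNorm _ _).trans ?_
      rw [hn1, mul_one]
    exact h1.trans (h2.trans (hC₁ t ht0 x))
  have hC₁abs : C₁ / (-t) ≤ |C₁| / (-t) := div_le_div_of_nonneg_right (le_abs_self _) hnt.le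
  -- assemble: `(−t)|∂₀v₂| = (−t)|∂₂v₀|/|μ| ≤ |C₁|/|μ| ≤ ε`
  rw [hcoord]
  have hkey : |fderiv ℝ (v t) x (EuclideanSpace.single 0 1) 2| =
      |fderiv ℝ (v t) x (EuclideanSpace.single 2 1) 0| / |μ t| := by
    rw [hrel, abs_mul, mul_div_cancel_left₀ _ hμpos.ne']
  rw [hkey]
  have h4 : (-t) * (|fderiv ℝ (v t) x (EuclideanSpace.single 2 1) 0| / |μ t|) ≤ |C₁| / |μ t| := by
    rw [← mul_div_assoc, div_le_div_iff_of_pos_right hμpos]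
    calc (-t) * |fderiv ℝ (v t) x (EuclideanSpace.single 2 1) 0| ≤ (-t) * (|C₁| / (-t)) :=
          mul_le_mul_of_nonneg_left (h3.trans hC₁abs) hnt.le
      _ = |C₁| := mul_div_cancel₀ _ hnt.ne'
  refine h4.trans ?_
  rw [div_le_iff₀ hμpos]
  have h5 : |C₁| / ε + 1 ≤ |μ t| := hM
  have h6 : |C₁| = ε * (|C₁| / ε) := by field_simp
  nlinarith [abs_nonneg C₁, h5, hε]

/-- The growth branch of (TV): not backward-singular. -/
theorem nonflatLiouville_of_timeShear_unbounded (hrate : HasTypeITimeDecay C v)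
    (hcont : ContinuousOn (uncurry v) (Iio (0 : ℝ) ×ˢ univ))
    (hmild : ∀ s t : ℝ, s < t → t < 0 → ∀ x,
      v t x = UnboundedOperators.heatExtension (v s) (t - s) x - oseenDuhamel 1 s v v t x)
    (hdiv : ∀ t < 0, VectorCalculus.IsDivFree (v t))
    (hpol : ∀ s < 0, ∀ y, ⟪curl (v s) y, EuclideanSpace.single 2 (1 : ℝ)⟫_ℝ = 0) {μ : ℝ → ℝ}
    (hslope : ∀ s < 0, ∀ y, ∀ b : Fin 3, b ≠ 2 →
      fderiv ℝ (v s) y (EuclideanSpace.single 2 1) b = μ s * fderiv ℝ (v s) y (EuclideanSpace.single b 1) 2)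
    (hμ : ∀ M : ℝ, ∃ T : ℝ, ∀ τ < T, M ≤ |μ τ|) :
    ¬ IsBackwardSingularPoint v 0 :=
  not_backwardSingular_of_zero (eq_zero_of_timeShear_unbounded hrate hcont hmild hdiv hpol hslope hμ)

end Summit.NavierStokesRegularity.NavierStokesRegularity.Theorems.PoloidalWindowDoorPoloidalWindowRigidityHorizontalFlatPast

end
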